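import Summits.HodgeConjecture.HodgeConjecture.Theorems.F0P3cStCharTSCartanDecompositionAd   -- (Q8) file 1 ∕ 2 (this seat): `isCompl_ker_range_adSubOne`, `mem_ker_adSubOne_iff`, `adInvSubOne_mem_range`, `eq_zero_of_adInvSubOne_eq_zero`
import Mathlib.LinearAlgebra.Projection
import HarnessLib

/-!
# F0 · P3c · line LH6 «StCharTS» — ROAD «JAC-ELL» brick (Q8) «CARTAN DECOMPOSITION OF `𝔲(J)` AT A REGULAR ELEMENT», file 2 ∕ 2: the descent of `M_n(K) = 𝔷(t₀) ⊕ (Ad_{t₀} − 1)M_n(K)`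
# to the `F`-Lie algebra `𝔲 = {X | (X.map σ)ᵀ J + J X = 0}` at a unitary `t₀`, and the linear part `L̃ = (Ad t₀⁻¹ − 1) ∘ pr_𝔪 + pr_𝔱` with its `K`-companion `Φ`

Cell `pub/hodgecm-mathlib`, crux H413 = `stmt-HodgeConjecture-24833` (lane `--supports … --as helper`), route HCCMUnconditional; seat F0P3-p04 (g18), brick (Q8) of LH5-p02 (g6)'s
road «JAC-ELL» (memo `F0/P3c/LH5/LH5-p02/g6/ROAD-JAC-ELL.v1.LH5p02g6.md` §1 row Q8, dealt 2026-09-02T15:20Z), in LH6-p02 (g6)'s C7 vocabulary (★ `F0P3cStCharTSAdRegularisedDet`: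
`Ad_t − 1 = LinearMap.mulLeftRight K (↑t, ↑t⁻¹) - LinearMap.id`, regularised operators `Φ` with (h1) `Φ ∘ (Ad_t − 1) = (Ad_{t⁻¹} − 1) ∘ (Ad_t − 1)`, (h2) `Φ Z = Z` on `𝔷(t)`).
THEOREMS ONLY (no definition ∕ instance ∕ notation ∕ named fact ∕ `sorry`); Mathlib + ★ C7.  The `F`-Lie algebra `𝔲` is a BINDER given by its FIELD HYPOTHESIS (road rule §2.1).
HONEST LABEL: HC_CM is proved only modulo the 7 printed citations (2 remaining: hLiu418 = `stmt-HodgeConjecture-24832`, h413 = `stmt-HodgeConjecture-24833`) until rung 0 closes;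
count-neutral linear algebra for the ELLIPTIC half of the print residue «WIF» of (S-𝔇); closes no organ.

THE MATHEMATICS ([HarishChandra1970, Lemma 22: the Jacobian `det((1 − Ad t)|_{𝔤∕𝔱})` of `(x, t) ↦ x t x⁻¹`]; [Rogawski1990, §12.5 p. 182]).  `t ∈ GL_n(K)` with SEPARABLE characteristic
polynomial, `K` perfect.  `Ad_t − 1 = R_{t⁻¹} ∘ δ_t` with `δ_t := L_t − R_t` (`L`, `R` = left ∕ right multiplication), `R_{t⁻¹}` an automorphism commuting with `δ_t`; `L_t`, `R_t` commute and
are killed by the separable `χ_t` (Cayley–Hamilton), hence are semisimple, hence so is `δ_t` (Mathlib `IsSemisimple.sub_of_commute`, perfect field); a semisimple endomorphism `f` of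
a finite-dimensional space has `ker f ⊕ range f = ⊤` (§1: an `f`-stable complement `q` of `ker f` has `f|_q` injective, so `range f = q`).  Hence **`M_n(K) = 𝔷(t) ⊕ 𝔪_K`**,
`𝔷(t) = ker(Ad_t − 1) = {Z | Zt = tZ}`, `𝔪_K = (Ad_t − 1)M_n(K)`, and `Ad_{t⁻¹} − 1 = −Ad_{t⁻¹} ∘ (Ad_t − 1)` is BIJECTIVE on `𝔪_K` (§2).  DESCENT (§3): for `σ : K →+* K` fixing
`F ⊆ K`, `J` invertible and `t₀` unitary (`(↑t₀.map σ)ᵀ J ↑t₀ = J`), the σ-semilinear map `τ(X) := J⁻¹ (X.map σ)ᵀ J` satisfies `τ ∘ Ad_{t₀} = Ad_{t₀} ∘ τ`, so it preserves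
`𝔷(t₀)` and `𝔪_K`; `X ∈ 𝔲 ⟺ τ X = −X`, and splitting `X = k + r` gives `−X = τk + τr`, so `k = −τk ∈ 𝔲`, `r = −τr ∈ 𝔲` by uniqueness: **`𝔲 = 𝔱 ⊕ 𝔪`** with `𝔱 = 𝔲 ∩ 𝔷(t₀)`,
`𝔪 = 𝔲 ∩ 𝔪_K` as `F`-submodules of `↥𝔲`; both are `Ad_s`-stable for every unitary `s ∈ Z(t₀)`.  LINEAR PART (§4): `L̃ := pr_𝔱 + (Ad_{t₀⁻¹} − 1) ∘ pr_𝔪` is an `F`-linear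
automorphism of `𝔲` (injective: `a + (Ad_{t₀⁻¹} − 1)b = 0` forces `a ∈ 𝔱 ∩ 𝔪 = 0` and then `b = 0` by §2; surjective by finite dimension), and its `K`-linear COMPANION
`Φ := pr_𝔷 + (Ad_{t₀⁻¹} − 1) ∘ pr_{𝔪_K}` on `M_n(K)` extends `L̃` and is a regularised Jacobian operator in the sense of ★ C7 ((h1) `Φ ∘ (Ad_{t₀} − 1) = (Ad_{t₀⁻¹} − 1) ∘ (Ad_{t₀} − 1)`,
(h2) `Φ = id` on `𝔷(t₀)`), so that ★ C7 gives `det_K Φ = −disc(χ_{t₀})∕det(t₀)²` and C7 file 3 reads `det_F L̃` against it (`𝔲 ⊗_F K = M_n(K)`) — delivered as an ∃-bundle (no definition).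
THIS FILE (2 ∕ 2): §3 `transpose_map_mul_eq_of_unitary`, `skew_conj_of_skew`, `tau_conj`, `skew_iff_tau_eq_neg`, **`isCompl_cartan`** (`IsCompl 𝔱 𝔪` in `↥𝔲`), `mem_cartanFixed_iff`,
`adInvSubOne_mem`, `conj_mem_cartan_of_comm`; §4 **`exists_cartanLinearPart`** (the ∃-bundle: `L̃ : ↥𝔲 ≃ₗ[F] ↥𝔲` with its laws, `Φ` extending it with ★ C7's (h1)(h2)).
FILE 1 ∕ 2 ★ `F0P3cStCharTSCartanDecompositionAd` carries the `K`-level (§1–§2).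

## References
* [HarishChandra1970] Harish-Chandra, *Harmonic analysis on reductive p-adic groups*, LNM 162 (1970), Lemma 22.
* [Rogawski1990] J. D. Rogawski, *Automorphic Representations of Unitary Groups in Three Variables*, Ann. of Math. Stud. 123 (1990), §12.5 p. 182; §4.9 p. 54.
-/

set_option autoImplicit false
-- the mandated namespace has the single-problem summit's repeated segment (`HodgeConjecture.HodgeConjecture`)
set_option linter.dupNamespace false

noncomputable section

open Polynomial Module
open scoped Matrix

namespace Summit.HodgeConjecture.HodgeConjecture.Cruxes.H413.F0P3cStCharTSCartanDecompositionSkew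

open Summit.HodgeConjecture.HodgeConjecture.Cruxes.H413.F0P3cStCharTSCartanDecompositionAd

/-! ## §3 Descent to the `F`-Lie algebra `𝔲 = {X | (X.map σ)ᵀ J + J X = 0}` at a unitary `t₀` -/

section Descent

variable {K : Type*} [Field K] {n : Type*} [Fintype n] [DecidableEq n] (σ : K →+* K) (J : Matrix n n K)

/-- The unitarity relation read two ways: for `s` unitary (`(↑s.map σ)ᵀ J ↑s = J`) one has `(↑s.map σ)ᵀ J = J ↑s⁻¹` and `J ↑s = (↑s⁻¹.map σ)ᵀ J`.
[cite: Rogawski1990, §1.9 p. 8] -/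
theorem transpose_map_mul_eq_of_unitary (s : GL n K) (hs : ((s : Matrix n n K).map σ)ᵀ * J * (s : Matrix n n K) = J) :
    ((s : Matrix n n K).map σ)ᵀ * J = J * ((s⁻¹ : GL n K) : Matrix n n K) ∧
      J * (s : Matrix n n K) = (((s⁻¹ : GL n K) : Matrix n n K).map σ)ᵀ * J := by
  have h1 : ((s : Matrix n n K).map σ)ᵀ * J = J * ((s⁻¹ : GL n K) : Matrix n n K) := by
    have h := congrArg (fun Y => Y * ((s⁻¹ : GL n K) : Matrix n n K)) hs
    simpa only [Matrix.mul_assoc, Units.mul_inv, Matrix.mul_one] using h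
  refine ⟨h1, ?_⟩
  -- `(↑s⁻¹.map σ)ᵀ (↑s.map σ)ᵀ = 1`
  have hinv : (((s⁻¹ : GL n K) : Matrix n n K).map σ)ᵀ * ((s : Matrix n n K).map σ)ᵀ = 1 := by
    rw [← Matrix.transpose_mul, ← Matrix.map_mul, Units.mul_inv, Matrix.map_one σ (map_zero σ) (map_one σ), Matrix.transpose_one]
  have h := congrArg (fun Y => (((s⁻¹ : GL n K) : Matrix n n K).map σ)ᵀ * Y * (s : Matrix n n K)) h1
  rw [← Matrix.mul_assoc, hinv, Matrix.one_mul, Matrix.mul_assoc, Matrix.mul_assoc, Units.inv_mul, Matrix.mul_one] at h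
  exact h

/-- **`Ad_s` preserves the skew set**: if `s` is unitary and `(X.map σ)ᵀ J + J X = 0` then the same holds for `s X s⁻¹` (indeed `c(sXs⁻¹) = (↑s⁻¹.map σ)ᵀ · c(X) · ↑s⁻¹`).
[cite: Rogawski1990, §1.9 p. 8] -/
theorem skew_conj_of_skew (s : GL n K) (hs : ((s : Matrix n n K).map σ)ᵀ * J * (s : Matrix n n K) = J) {X : Matrix n n K}
    (hX : (X.map σ)ᵀ * J + J * X = 0) :
    (((s : Matrix n n K) * X * ((s⁻¹ : GL n K) : Matrix n n K)).map σ)ᵀ * J + J * ((s : Matrix n n K) * X * ((s⁻¹ : GL n K) : Matrix n n K)) = 0 := by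
  obtain ⟨h1, h2⟩ := transpose_map_mul_eq_of_unitary σ J s hs
  have key : (((s : Matrix n n K) * X * ((s⁻¹ : GL n K) : Matrix n n K)).map σ)ᵀ * J + J * ((s : Matrix n n K) * X * ((s⁻¹ : GL n K) : Matrix n n K)) =
      (((s⁻¹ : GL n K) : Matrix n n K).map σ)ᵀ * ((X.map σ)ᵀ * J + J * X) * ((s⁻¹ : GL n K) : Matrix n n K) := by
    have e1 : (((s : Matrix n n K) * X * ((s⁻¹ : GL n K) : Matrix n n K)).map σ)ᵀ =
        (((s⁻¹ : GL n K) : Matrix n n K).map σ)ᵀ * ((X.map σ)ᵀ * ((s : Matrix n n K).map σ)ᵀ) := by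
      rw [Matrix.map_mul, Matrix.map_mul, Matrix.transpose_mul, Matrix.transpose_mul]
    have t1 : (((s⁻¹ : GL n K) : Matrix n n K).map σ)ᵀ * ((X.map σ)ᵀ * ((s : Matrix n n K).map σ)ᵀ) * J =
        (((s⁻¹ : GL n K) : Matrix n n K).map σ)ᵀ * ((X.map σ)ᵀ * (J * ((s⁻¹ : GL n K) : Matrix n n K))) := by
      rw [Matrix.mul_assoc, Matrix.mul_assoc, h1]
    have t2 : J * ((s : Matrix n n K) * X * ((s⁻¹ : GL n K) : Matrix n n K)) = (((s⁻¹ : GL n K) : Matrix n n K).map σ)ᵀ * J * X * ((s⁻¹ : GL n K) : Matrix n n K) := by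
      rw [← Matrix.mul_assoc, ← Matrix.mul_assoc, h2]
    rw [e1, t1, t2]
    simp only [Matrix.mul_add, Matrix.add_mul, Matrix.mul_assoc]
  rw [key, hX, Matrix.mul_zero, Matrix.zero_mul]

variable (hJ : IsUnit J.det)
include hJ

/-- The σ-semilinear map `τ(Y) := J⁻¹ (Y.map σ)ᵀ J` COMMUTES WITH `Ad(t₀)` for `t₀` unitary: `τ(t₀ Y t₀⁻¹) = t₀ τ(Y) t₀⁻¹`. [cite: Rogawski1990, §1.9 p. 8] -/
theorem tau_conj (t₀ : GL n K) (ht₀ : ((t₀ : Matrix n n K).map σ)ᵀ * J * (t₀ : Matrix n n K) = J) (Y : Matrix n n K) :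
    J⁻¹ * (((t₀ : Matrix n n K) * Y * ((t₀⁻¹ : GL n K) : Matrix n n K)).map σ)ᵀ * J =
      (t₀ : Matrix n n K) * (J⁻¹ * (Y.map σ)ᵀ * J) * ((t₀⁻¹ : GL n K) : Matrix n n K) := by
  obtain ⟨h1, h2⟩ := transpose_map_mul_eq_of_unitary σ J t₀ ht₀
  -- `J⁻¹ (↑t₀⁻¹.map σ)ᵀ = ↑t₀ J⁻¹`
  have h3 : J⁻¹ * (((t₀⁻¹ : GL n K) : Matrix n n K).map σ)ᵀ = (t₀ : Matrix n n K) * J⁻¹ := by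
    have h := congrArg (fun Y => J⁻¹ * Y * J⁻¹) h2
    rw [← Matrix.mul_assoc, Matrix.nonsing_inv_mul J hJ, Matrix.one_mul, Matrix.mul_assoc, Matrix.mul_assoc, Matrix.mul_nonsing_inv J hJ, Matrix.mul_one] at h
    exact h.symm
  rw [Matrix.map_mul, Matrix.map_mul, Matrix.transpose_mul, Matrix.transpose_mul, ← Matrix.mul_assoc, ← Matrix.mul_assoc, h3, Matrix.mul_assoc, Matrix.mul_assoc,
    Matrix.mul_assoc, h1]
  simp only [Matrix.mul_assoc]

/-- Membership in `𝔲` through `τ`: `(X.map σ)ᵀ J + J X = 0 ↔ J⁻¹ (X.map σ)ᵀ J = −X` (`J` invertible). [cite: Rogawski1990, §1.9 p. 8] -/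
theorem skew_iff_tau_eq_neg (X : Matrix n n K) : (X.map σ)ᵀ * J + J * X = 0 ↔ J⁻¹ * (X.map σ)ᵀ * J = -X := by
  constructor
  · intro h
    rw [add_eq_zero_iff_eq_neg] at h
    rw [Matrix.mul_assoc, h, Matrix.mul_neg, ← Matrix.mul_assoc, Matrix.nonsing_inv_mul J hJ, Matrix.one_mul]
  · intro h
    have h' := congrArg (fun Y => J * Y) h
    rw [← Matrix.mul_assoc, ← Matrix.mul_assoc, Matrix.mul_nonsing_inv J hJ, Matrix.one_mul, Matrix.mul_neg] at h'
    rw [h', neg_add_cancel]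

variable {F : Type*} [Field F] [Algebra F K]

/-- **THE CARTAN DECOMPOSITION OF `𝔲` AT A UNITARY REGULAR `t₀`: `𝔲 = 𝔱 ⊕ 𝔪`** with `𝔱 = 𝔲 ∩ 𝔷(t₀)` and `𝔪 = 𝔲 ∩ (Ad(t₀) − 1)M_n(K)`, as `F`-submodules of `↥𝔲`
(`𝔲` any `F`-submodule with carrier the skew set — field hypothesis `h𝔲`; `J` invertible; `t₀` unitary with separable characteristic polynomial; `K` perfect).  The `K`-splitting
`X = k + r` of `X ∈ 𝔲` has `τ k ∈ 𝔷`, `τ r ∈ 𝔪_K` (`tau_conj`) and `τ X = −X`, so `τ k = −k`, `τ r = −r` by uniqueness — both parts are skew.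
[cite: HarishChandra1970, Lemma 22] [cite: Rogawski1990, §12.5 p. 182; §1.9 p. 8] -/
theorem isCompl_cartan [PerfectField K] (𝔲 : Submodule F (Matrix n n K)) (h𝔲 : ∀ X : Matrix n n K, X ∈ 𝔲 ↔ (X.map σ)ᵀ * J + J * X = 0)
    (t₀ : GL n K) (ht₀ : ((t₀ : Matrix n n K).map σ)ᵀ * J * (t₀ : Matrix n n K) = J) (hsep : (t₀ : Matrix n n K).charpoly.Separable) :
    IsCompl (((LinearMap.ker (LinearMap.mulLeftRight K ((t₀ : Matrix n n K), ((t₀⁻¹ : GL n K) : Matrix n n K)) - LinearMap.id : Matrix n n K →ₗ[K] Matrix n n K)).restrictScalars F).comap 𝔲.subtype) (((LinearMap.range (LinearMap.mulLeftRight K ((t₀ : Matrix n n K), ((t₀⁻¹ : GL n K) : Matrix n n K)) - LinearMap.id : Matrix n n K →ₗ[K] Matrix n n K)).restrictScalars F).comap 𝔲.subtype) := by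
  have hK := isCompl_ker_range_adSubOne t₀ hsep
  refine ⟨?_, ?_⟩
  · rw [Submodule.disjoint_def]
    intro X hX1 hX2
    rw [Submodule.mem_comap, Submodule.restrictScalars_mem] at hX1 hX2
    have h := hK.disjoint
    rw [Submodule.disjoint_def] at h
    exact Subtype.ext (h _ hX1 hX2)
  · rw [codisjoint_iff, eq_top_iff]
    rintro X -
    have hX := (h𝔲 (X : Matrix n n K)).1 X.2
    -- the `K`-splitting of `↑X`
    have htop : (X : Matrix n n K) ∈ LinearMap.ker (LinearMap.mulLeftRight K ((t₀ : Matrix n n K), ((t₀⁻¹ : GL n K) : Matrix n n K)) - LinearMap.id : Matrix n n K →ₗ[K] Matrix n n K) ⊔ LinearMap.range (LinearMap.mulLeftRight K ((t₀ : Matrix n n K), ((t₀⁻¹ : GL n K) : Matrix n n K)) - LinearMap.id : Matrix n n K →ₗ[K] Matrix n n K) := by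
      rw [hK.sup_eq_top]; exact Submodule.mem_top
    obtain ⟨k, hk, r, hr, hkr⟩ := Submodule.mem_sup.1 htop
    -- `τ` preserves `𝔷` and `𝔪_K`
    have hτk : -(J⁻¹ * (k.map σ)ᵀ * J) ∈ LinearMap.ker (LinearMap.mulLeftRight K ((t₀ : Matrix n n K), ((t₀⁻¹ : GL n K) : Matrix n n K)) - LinearMap.id : Matrix n n K →ₗ[K] Matrix n n K) := by
      refine Submodule.neg_mem _ ?_
      rw [mem_ker_adSubOne_iff] at hk ⊢
      have hc : (t₀ : Matrix n n K) * k * ((t₀⁻¹ : GL n K) : Matrix n n K) = k := by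
        rw [← hk, Matrix.mul_assoc, Units.mul_inv, Matrix.mul_one]
      have h := tau_conj σ J hJ t₀ ht₀ k
      rw [hc] at h
      have h' := congrArg (fun Y => Y * (t₀ : Matrix n n K)) h
      simpa only [Matrix.mul_assoc, Units.inv_mul, Matrix.mul_one] using h'
    have hτr : -(J⁻¹ * (r.map σ)ᵀ * J) ∈ LinearMap.range (LinearMap.mulLeftRight K ((t₀ : Matrix n n K), ((t₀⁻¹ : GL n K) : Matrix n n K)) - LinearMap.id : Matrix n n K →ₗ[K] Matrix n n K) := by
      refine Submodule.neg_mem _ ?_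
      obtain ⟨Y, rfl⟩ := hr
      refine ⟨J⁻¹ * (Y.map σ)ᵀ * J, ?_⟩
      simp only [LinearMap.sub_apply, LinearMap.mulLeftRight_apply, LinearMap.id_apply]
      rw [Matrix.map_sub _ (map_sub σ), Matrix.transpose_sub, Matrix.mul_sub, Matrix.sub_mul, tau_conj σ J hJ t₀ ht₀ Y]
    -- uniqueness of the splitting: `−X = τ k + τ r = (−k) + (−r)`
    have hτX : J⁻¹ * ((X : Matrix n n K).map σ)ᵀ * J = -(X : Matrix n n K) := (skew_iff_tau_eq_neg σ J hJ _).1 hX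
    have hsum : (-(J⁻¹ * (k.map σ)ᵀ * J) - k) + (-(J⁻¹ * (r.map σ)ᵀ * J) - r) = 0 := by
      have h : J⁻¹ * ((X : Matrix n n K).map σ)ᵀ * J = J⁻¹ * (k.map σ)ᵀ * J + J⁻¹ * (r.map σ)ᵀ * J := by
        rw [← hkr, Matrix.map_add _ (map_add σ), Matrix.transpose_add, Matrix.mul_add, Matrix.add_mul]
      rw [hτX, ← hkr] at h
      rw [show (-(J⁻¹ * (k.map σ)ᵀ * J) - k) + (-(J⁻¹ * (r.map σ)ᵀ * J) - r) = -((J⁻¹ * (k.map σ)ᵀ * J + J⁻¹ * (r.map σ)ᵀ * J) + (k + r)) by abel, ← h, neg_add_cancel, neg_zero]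
    have hd := hK.disjoint
    rw [Submodule.disjoint_def] at hd
    have hkk : -(J⁻¹ * (k.map σ)ᵀ * J) - k = 0 := by
      refine hd _ (Submodule.sub_mem _ hτk hk) ?_
      have : -(J⁻¹ * (k.map σ)ᵀ * J) - k = -((-(J⁻¹ * (r.map σ)ᵀ * J) - r)) := by rw [← add_eq_zero_iff_eq_neg]; exact hsum
      rw [this]
      exact Submodule.neg_mem _ (Submodule.sub_mem _ hτr hr)
    have hrr : -(J⁻¹ * (r.map σ)ᵀ * J) - r = 0 := by rw [hkk, zero_add] at hsum; exact hsum
    -- hence `k`, `r` are skew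
    have hk𝔲 : k ∈ 𝔲 := (h𝔲 k).2 ((skew_iff_tau_eq_neg σ J hJ k).2 (by rw [sub_eq_zero] at hkk; exact neg_eq_iff_eq_neg.1 hkk))
    have hr𝔲 : r ∈ 𝔲 := (h𝔲 r).2 ((skew_iff_tau_eq_neg σ J hJ r).2 (by rw [sub_eq_zero] at hrr; exact neg_eq_iff_eq_neg.1 hrr))
    have hXeq : X = (⟨k, hk𝔲⟩ : ↥𝔲) + ⟨r, hr𝔲⟩ := Subtype.ext hkr.symm
    rw [hXeq]
    exact Submodule.add_mem_sup (by rw [Submodule.mem_comap, Submodule.restrictScalars_mem]; exact hk)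
      (by rw [Submodule.mem_comap, Submodule.restrictScalars_mem]; exact hr)

omit hJ in
/-- `𝔱 = 𝔲 ∩ 𝔷(t₀)` read as commutation: `X ∈ 𝔱 ↔ ↑X t₀ = t₀ ↑X`. [cite: HarishChandra1970, Lemma 22] -/
theorem mem_cartanFixed_iff (𝔲 : Submodule F (Matrix n n K)) (t₀ : GL n K) (X : ↥𝔲) :
    X ∈ (((LinearMap.ker (LinearMap.mulLeftRight K ((t₀ : Matrix n n K), ((t₀⁻¹ : GL n K) : Matrix n n K)) - LinearMap.id : Matrix n n K →ₗ[K] Matrix n n K)).restrictScalars F).comap 𝔲.subtype) ↔ (X : Matrix n n K) * (t₀ : Matrix n n K) = (t₀ : Matrix n n K) * (X : Matrix n n K) := by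
  rw [Submodule.mem_comap, Submodule.restrictScalars_mem, Submodule.subtype_apply, mem_ker_adSubOne_iff]

omit hJ in
/-- `Ad(t₀⁻¹) − 1` maps `𝔲` into `𝔲` for `t₀` unitary. [cite: Rogawski1990, §1.9 p. 8] -/
theorem adInvSubOne_mem (𝔲 : Submodule F (Matrix n n K)) (h𝔲 : ∀ X : Matrix n n K, X ∈ 𝔲 ↔ (X.map σ)ᵀ * J + J * X = 0)
    (t₀ : GL n K) (ht₀ : ((t₀ : Matrix n n K).map σ)ᵀ * J * (t₀ : Matrix n n K) = J) (X : Matrix n n K) (hX : X ∈ 𝔲) :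
    (LinearMap.mulLeftRight K (((t₀⁻¹ : GL n K) : Matrix n n K), (t₀ : Matrix n n K)) - LinearMap.id : Matrix n n K →ₗ[K] Matrix n n K) X ∈ 𝔲 := by
  rw [LinearMap.sub_apply, LinearMap.mulLeftRight_apply, LinearMap.id_apply]
  refine Submodule.sub_mem _ ((h𝔲 _).2 ?_) hX
  have hs : (((t₀⁻¹ : GL n K) : Matrix n n K).map σ)ᵀ * J * ((t₀⁻¹ : GL n K) : Matrix n n K) = J := by
    obtain ⟨-, h2⟩ := transpose_map_mul_eq_of_unitary σ J t₀ ht₀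
    rw [← h2, Matrix.mul_assoc, Units.mul_inv, Matrix.mul_one]
  have h := skew_conj_of_skew σ J (t₀⁻¹) hs ((h𝔲 X).1 hX)
  rwa [inv_inv] at h

omit hJ in
/-- `Ad_s` for a unitary `s ∈ Z(t₀)` preserves `𝔱` and `𝔪` (it preserves `𝔲`, and commutes with `Ad(t₀)`). [cite: HarishChandra1970, Lemma 22] -/
theorem conj_mem_cartan_of_comm (𝔲 : Submodule F (Matrix n n K)) (h𝔲 : ∀ X : Matrix n n K, X ∈ 𝔲 ↔ (X.map σ)ᵀ * J + J * X = 0)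
    (t₀ s : GL n K) (hs : ((s : Matrix n n K).map σ)ᵀ * J * (s : Matrix n n K) = J) (hst : (s : Matrix n n K) * (t₀ : Matrix n n K) = (t₀ : Matrix n n K) * (s : Matrix n n K))
    (X : ↥𝔲) :
    (X ∈ (((LinearMap.ker (LinearMap.mulLeftRight K ((t₀ : Matrix n n K), ((t₀⁻¹ : GL n K) : Matrix n n K)) - LinearMap.id : Matrix n n K →ₗ[K] Matrix n n K)).restrictScalars F).comap 𝔲.subtype) →
      ∃ hY : (s : Matrix n n K) * (X : Matrix n n K) * ((s⁻¹ : GL n K) : Matrix n n K) ∈ 𝔲, (⟨_, hY⟩ : ↥𝔲) ∈ (((LinearMap.ker (LinearMap.mulLeftRight K ((t₀ : Matrix n n K), ((t₀⁻¹ : GL n K) : Matrix n n K)) - LinearMap.id : Matrix n n K →ₗ[K] Matrix n n K)).restrictScalars F).comap 𝔲.subtype)) ∧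
    (X ∈ (((LinearMap.range (LinearMap.mulLeftRight K ((t₀ : Matrix n n K), ((t₀⁻¹ : GL n K) : Matrix n n K)) - LinearMap.id : Matrix n n K →ₗ[K] Matrix n n K)).restrictScalars F).comap 𝔲.subtype) →
      ∃ hY : (s : Matrix n n K) * (X : Matrix n n K) * ((s⁻¹ : GL n K) : Matrix n n K) ∈ 𝔲, (⟨_, hY⟩ : ↥𝔲) ∈ (((LinearMap.range (LinearMap.mulLeftRight K ((t₀ : Matrix n n K), ((t₀⁻¹ : GL n K) : Matrix n n K)) - LinearMap.id : Matrix n n K →ₗ[K] Matrix n n K)).restrictScalars F).comap 𝔲.subtype)) := by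
  have hY : (s : Matrix n n K) * (X : Matrix n n K) * ((s⁻¹ : GL n K) : Matrix n n K) ∈ 𝔲 := (h𝔲 _).2 (skew_conj_of_skew σ J s hs ((h𝔲 _).1 X.2))
  -- `s⁻¹` commutes with `t₀` too
  have hst' : ((s⁻¹ : GL n K) : Matrix n n K) * (t₀ : Matrix n n K) = (t₀ : Matrix n n K) * ((s⁻¹ : GL n K) : Matrix n n K) := by
    have h := congrArg (fun Y => ((s⁻¹ : GL n K) : Matrix n n K) * Y * ((s⁻¹ : GL n K) : Matrix n n K)) hst
    simpa only [Matrix.mul_assoc, Units.mul_inv, Matrix.mul_one, ← Matrix.mul_assoc ((s⁻¹ : GL n K) : Matrix n n K) (s : Matrix n n K), Units.inv_mul,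
      Matrix.one_mul] using h.symm
  refine ⟨fun h => ⟨hY, ?_⟩, fun h => ⟨hY, ?_⟩⟩
  · rw [mem_cartanFixed_iff] at h ⊢
    simp only [Matrix.mul_assoc, hst']
    rw [← Matrix.mul_assoc (X : Matrix n n K), h, Matrix.mul_assoc, ← Matrix.mul_assoc (s : Matrix n n K), hst, Matrix.mul_assoc]
  · rw [Submodule.mem_comap, Submodule.restrictScalars_mem, Submodule.subtype_apply] at h ⊢
    obtain ⟨Y, hYX⟩ := h
    refine ⟨(s : Matrix n n K) * Y * ((s⁻¹ : GL n K) : Matrix n n K), ?_⟩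
    simp only [LinearMap.sub_apply, LinearMap.mulLeftRight_apply, LinearMap.id_apply] at hYX ⊢
    rw [← hYX, Matrix.mul_sub, Matrix.sub_mul]
    have hti : ((t₀⁻¹ : GL n K) : Matrix n n K) * ((s⁻¹ : GL n K) : Matrix n n K) = ((s⁻¹ : GL n K) : Matrix n n K) * ((t₀⁻¹ : GL n K) : Matrix n n K) := by
      rw [← Units.val_mul, ← Units.val_mul, ← mul_inv_rev, ← mul_inv_rev]
      congr 2
      exact Units.ext (by rw [Units.val_mul, Units.val_mul]; exact hst)
    simp only [Matrix.mul_assoc, hti]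
    rw [← Matrix.mul_assoc (t₀ : Matrix n n K) (s : Matrix n n K), ← hst, Matrix.mul_assoc]

end Descent


/-! ## §4 The linear part `L̃ = pr_𝔱 + (Ad(t₀⁻¹) − 1) ∘ pr_𝔪` as an `F`-linear automorphism of `𝔲`, and its `K`-linear companion `Φ` (C7's regularised operator) -/

section LinearPart

variable {K : Type*} [Field K] [PerfectField K] {n : Type*} [Fintype n] [DecidableEq n] (σ : K →+* K) (J : Matrix n n K) (hJ : IsUnit J.det)
  {F : Type*} [Field F] [Algebra F K] [FiniteDimensional F K]

include hJ in
/-- **THE ∃-BUNDLE «CARTAN LINEAR PART».**  For `𝔲` (skew set, field hypothesis), `J` invertible, `t₀` unitary with separable characteristic polynomial, `[K : F] < ∞`: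
with `𝔱 = 𝔲 ∩ 𝔷(t₀)`, `𝔪 = 𝔲 ∩ (Ad(t₀) − 1)M_n(K)` (`IsCompl 𝔱 𝔪`, ★ `isCompl_cartan`) there are an `F`-linear automorphism `L̃ : ↥𝔲 ≃ₗ[F] ↥𝔲` and a `K`-linear
`Φ : M_n(K) →ₗ[K] M_n(K)` such that: `L̃ = id` on `𝔱`; `L̃ X = t₀⁻¹ X t₀ − X` on `𝔪`; `L̃ X = pr_𝔱 X + L̃ (pr_𝔪 X)` (Mathlib `Submodule.projectionOnto`); `Φ` EXTENDS `L̃`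
(`Φ ↑X = ↑(L̃ X)`); and `Φ` is a REGULARISED JACOBIAN OPERATOR in the sense of ★ C7 (`F0P3cStCharTSAdRegularisedDet`): (h1) `Φ ∘ (Ad(t₀) − 1) = (Ad(t₀⁻¹) − 1) ∘ (Ad(t₀) − 1)`,
(h2) `Φ Z = Z` whenever `Z t₀ = t₀ Z` — so ★ C7 computes `det_K Φ = −disc(χ_{t₀})∕det(t₀)²`, and C7 file 3 reads `det_F L̃` against it (`𝔲 ⊗_F K = M_n(K)`).  This `L̃` is the
linear part of the twisted Cayley sandwich `Θ(X, Y) = S(Ad(t₀⁻¹)X, S(Y, −X))` of road «JAC-ELL» (C5∕C8a). [cite: HarishChandra1970, Lemma 22] [cite: Rogawski1990, §12.5 p. 182; §4.9 p. 54] -/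
theorem exists_cartanLinearPart (𝔲 : Submodule F (Matrix n n K)) (h𝔲 : ∀ X : Matrix n n K, X ∈ 𝔲 ↔ (X.map σ)ᵀ * J + J * X = 0)
    (t₀ : GL n K) (ht₀ : ((t₀ : Matrix n n K).map σ)ᵀ * J * (t₀ : Matrix n n K) = J) (hsep : (t₀ : Matrix n n K).charpoly.Separable) :
    ∃ (hc : IsCompl (((LinearMap.ker (LinearMap.mulLeftRight K ((t₀ : Matrix n n K), ((t₀⁻¹ : GL n K) : Matrix n n K)) - LinearMap.id : Matrix n n K →ₗ[K] Matrix n n K)).restrictScalars F).comap 𝔲.subtype) (((LinearMap.range (LinearMap.mulLeftRight K ((t₀ : Matrix n n K), ((t₀⁻¹ : GL n K) : Matrix n n K)) - LinearMap.id : Matrix n n K →ₗ[K] Matrix n n K)).restrictScalars F).comap 𝔲.subtype))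
      (L : ↥𝔲 ≃ₗ[F] ↥𝔲) (Φ : Matrix n n K →ₗ[K] Matrix n n K),
      (∀ X : ↥𝔲, X ∈ (((LinearMap.ker (LinearMap.mulLeftRight K ((t₀ : Matrix n n K), ((t₀⁻¹ : GL n K) : Matrix n n K)) - LinearMap.id : Matrix n n K →ₗ[K] Matrix n n K)).restrictScalars F).comap 𝔲.subtype) → L X = X) ∧
      (∀ X : ↥𝔲, X ∈ (((LinearMap.range (LinearMap.mulLeftRight K ((t₀ : Matrix n n K), ((t₀⁻¹ : GL n K) : Matrix n n K)) - LinearMap.id : Matrix n n K →ₗ[K] Matrix n n K)).restrictScalars F).comap 𝔲.subtype) → ((L X : ↥𝔲) : Matrix n n K) = ((t₀⁻¹ : GL n K) : Matrix n n K) * (X : Matrix n n K) * (t₀ : Matrix n n K) - (X : Matrix n n K)) ∧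
      (∀ X : ↥𝔲, L X = ((Submodule.projectionOnto (((LinearMap.ker (LinearMap.mulLeftRight K ((t₀ : Matrix n n K), ((t₀⁻¹ : GL n K) : Matrix n n K)) - LinearMap.id : Matrix n n K →ₗ[K] Matrix n n K)).restrictScalars F).comap 𝔲.subtype) (((LinearMap.range (LinearMap.mulLeftRight K ((t₀ : Matrix n n K), ((t₀⁻¹ : GL n K) : Matrix n n K)) - LinearMap.id : Matrix n n K →ₗ[K] Matrix n n K)).restrictScalars F).comap 𝔲.subtype) hc X : ↥(((LinearMap.ker (LinearMap.mulLeftRight K ((t₀ : Matrix n n K), ((t₀⁻¹ : GL n K) : Matrix n n K)) - LinearMap.id : Matrix n n K →ₗ[K] Matrix n n K)).restrictScalars F).comap 𝔲.subtype)) : ↥𝔲) + L ((Submodule.projectionOnto (((LinearMap.range (LinearMap.mulLeftRight K ((t₀ : Matrix n n K), ((t₀⁻¹ : GL n K) : Matrix n n K)) - LinearMap.id : Matrix n n K →ₗ[K] Matrix n n K)).restrictScalars F).comap 𝔲.subtype) (((LinearMap.ker (LinearMap.mulLeftRight K ((t₀ : Matrix n n K), ((t₀⁻¹ : GL n K) :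 Matrix n n K)) - LinearMap.id : Matrix n n K →ₗ[K] Matrix n n K)).restrictScalars F).comap 𝔲.subtype) hc.symm X : ↥(((LinearMap.range (LinearMap.mulLeftRight K ((t₀ : Matrix n n K), ((t₀⁻¹ : GL n K) : Matrix n n K)) - LinearMap.id : Matrix n n K →ₗ[K] Matrix n n K)).restrictScalars F).comap 𝔲.subtype)) : ↥𝔲)) ∧
      (∀ X : ↥𝔲, Φ (X : Matrix n n K) = ((L X : ↥𝔲) : Matrix n n K)) ∧
      Φ ∘ₗ (LinearMap.mulLeftRight K ((t₀ : Matrix n n K), ((t₀⁻¹ : GL n K) : Matrix n n K)) - LinearMap.id : Matrix n n K →ₗ[K] Matrix n n K) = (LinearMap.mulLeftRight K (((t₀⁻¹ : GL n K) : Matrix n n K), (t₀ : Matrix n n K)) - LinearMap.id : Matrix n n K →ₗ[K] Matrix n n K) ∘ₗ (LinearMap.mulLeftRight K ((t₀ : Matrix n n K), ((t₀⁻¹ : GL n K) : Matrix n n K)) - LinearMap.id : Matrix n n K →ₗ[K] Matrix n n K) ∧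
      (∀ Z : Matrix n n K, Z * (t₀ : Matrix n n K) = (t₀ : Matrix n n K) * Z → Φ Z = Z) := by
  have hc := isCompl_cartan σ J hJ 𝔲 h𝔲 t₀ ht₀ hsep
  have hK := isCompl_ker_range_adSubOne t₀ hsep
  -- `Ad(t₀⁻¹) − 1` as an `F`-linear endomorphism of `𝔲`
  set g : Matrix n n K →ₗ[F] Matrix n n K := ((LinearMap.mulLeftRight K (((t₀⁻¹ : GL n K) : Matrix n n K), (t₀ : Matrix n n K)) - LinearMap.id : Matrix n n K →ₗ[K] Matrix n n K)).restrictScalars F with hg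
  have hg𝔲 : ∀ X ∈ 𝔲, g X ∈ 𝔲 := fun X hX => by
    rw [hg, LinearMap.restrictScalars_apply]; exact adInvSubOne_mem σ J 𝔲 h𝔲 t₀ ht₀ X hX
  set g𝔲 : ↥𝔲 →ₗ[F] ↥𝔲 := g.restrict hg𝔲 with hg𝔲def
  have hg𝔲val : ∀ X : ↥𝔲, ((g𝔲 X : ↥𝔲) : Matrix n n K) = ((t₀⁻¹ : GL n K) : Matrix n n K) * (X : Matrix n n K) * (t₀ : Matrix n n K) - (X : Matrix n n K) :=
    fun X => rfl
  have hg𝔪 : ∀ X : ↥𝔲, g𝔲 X ∈ (((LinearMap.range (LinearMap.mulLeftRight K ((t₀ : Matrix n n K), ((t₀⁻¹ : GL n K) : Matrix n n K)) - LinearMap.id : Matrix n n K →ₗ[K] Matrix n n K)).restrictScalars F).comap 𝔲.subtype) := fun X => by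
    rw [Submodule.mem_comap, Submodule.restrictScalars_mem, Submodule.subtype_apply]
    exact adInvSubOne_mem_range t₀ _
  -- the `F`-linear map `L̃ := pr_𝔱 + g ∘ pr_𝔪`
  set Ll : ↥𝔲 →ₗ[F] ↥𝔲 := LinearMap.ofIsCompl hc (Submodule.subtype _) (g𝔲 ∘ₗ Submodule.subtype _) with hLl
  have hLl_left : ∀ X : ↥𝔲, X ∈ (((LinearMap.ker (LinearMap.mulLeftRight K ((t₀ : Matrix n n K), ((t₀⁻¹ : GL n K) : Matrix n n K)) - LinearMap.id : Matrix n n K →ₗ[K] Matrix n n K)).restrictScalars F).comap 𝔲.subtype) → Ll X = X := fun X hX => LinearMap.ofIsCompl_apply_left hc (⟨X, hX⟩ : ↥(((LinearMap.ker (LinearMap.mulLeftRight K ((t₀ : Matrix n n K), ((t₀⁻¹ : GL n K) : Matrix n n K)) - LinearMap.id : Matrix n n K →ₗ[K] Matrix n n K)).restrictScalars F).comap 𝔲.subtype))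
  have hLl_right : ∀ X : ↥𝔲, X ∈ (((LinearMap.range (LinearMap.mulLeftRight K ((t₀ : Matrix n n K), ((t₀⁻¹ : GL n K) : Matrix n n K)) - LinearMap.id : Matrix n n K →ₗ[K] Matrix n n K)).restrictScalars F).comap 𝔲.subtype) → Ll X = g𝔲 X := fun X hX => LinearMap.ofIsCompl_apply_right hc (⟨X, hX⟩ : ↥(((LinearMap.range (LinearMap.mulLeftRight K ((t₀ : Matrix n n K), ((t₀⁻¹ : GL n K) : Matrix n n K)) - LinearMap.id : Matrix n n K →ₗ[K] Matrix n n K)).restrictScalars F).comap 𝔲.subtype))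
  -- `L̃` is injective: if `L̃(a + b) = a + g b = 0` then `a = −g b ∈ 𝔱 ∩ 𝔪 = 0` and `g b = 0`, so `b = 0` (★ §2)
  have hLl0 : ∀ X : ↥𝔲, Ll X = 0 → X = 0 := by
    intro X hX
    have htop : X ∈ (((LinearMap.ker (LinearMap.mulLeftRight K ((t₀ : Matrix n n K), ((t₀⁻¹ : GL n K) : Matrix n n K)) - LinearMap.id : Matrix n n K →ₗ[K] Matrix n n K)).restrictScalars F).comap 𝔲.subtype) ⊔ (((LinearMap.range (LinearMap.mulLeftRight K ((t₀ : Matrix n n K), ((t₀⁻¹ : GL n K) : Matrix n n K)) - LinearMap.id : Matrix n n K →ₗ[K] Matrix n n K)).restrictScalars F).comap 𝔲.subtype) := by rw [hc.sup_eq_top]; exact Submodule.mem_top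
    obtain ⟨a, ha, b, hb, rfl⟩ := Submodule.mem_sup.1 htop
    rw [map_add, hLl_left a ha, hLl_right b hb] at hX
    have ha' : a = -g𝔲 b := eq_neg_of_add_eq_zero_left hX
    have hd := hc.disjoint
    rw [Submodule.disjoint_def] at hd
    have ha0 : a = 0 := hd a ha (by rw [ha']; exact Submodule.neg_mem _ (hg𝔪 b))
    rw [ha0, zero_add] at hX
    have hbK : (b : Matrix n n K) ∈ LinearMap.range (LinearMap.mulLeftRight K ((t₀ : Matrix n n K), ((t₀⁻¹ : GL n K) : Matrix n n K)) - LinearMap.id : Matrix n n K →ₗ[K] Matrix n n K) := by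
      rw [Submodule.mem_comap, Submodule.restrictScalars_mem, Submodule.subtype_apply] at hb; exact hb
    have hb0 : (b : Matrix n n K) = 0 := eq_zero_of_adInvSubOne_eq_zero t₀ hsep hbK (congrArg (fun Z : ↥𝔲 => (Z : Matrix n n K)) hX)
    rw [ha0, zero_add]
    exact Subtype.ext hb0
  have hinj : Function.Injective Ll := by
    intro X₁ X₂ h
    have h0 : Ll (X₁ - X₂) = 0 := by rw [map_sub, h, sub_self]
    exact sub_eq_zero.1 (hLl0 _ h0)
  have hbij : Function.Bijective Ll := ⟨hinj, LinearMap.injective_iff_surjective.mp hinj⟩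
  set L : ↥𝔲 ≃ₗ[F] ↥𝔲 := LinearEquiv.ofBijective Ll hbij with hL
  have hLL : ∀ X : ↥𝔲, L X = Ll X := fun X => rfl
  -- the `K`-linear companion `Φ := pr_𝔷 + (Ad(t₀⁻¹) − 1) ∘ pr_{𝔪_K}`
  set Φ : Matrix n n K →ₗ[K] Matrix n n K := LinearMap.ofIsCompl hK (Submodule.subtype _) ((LinearMap.mulLeftRight K (((t₀⁻¹ : GL n K) : Matrix n n K), (t₀ : Matrix n n K)) - LinearMap.id : Matrix n n K →ₗ[K] Matrix n n K) ∘ₗ Submodule.subtype _) with hΦ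
  have hΦ_left : ∀ Z : Matrix n n K, Z ∈ LinearMap.ker (LinearMap.mulLeftRight K ((t₀ : Matrix n n K), ((t₀⁻¹ : GL n K) : Matrix n n K)) - LinearMap.id : Matrix n n K →ₗ[K] Matrix n n K) → Φ Z = Z := fun Z hZ => LinearMap.ofIsCompl_apply_left hK (⟨Z, hZ⟩ : ↥(LinearMap.ker (LinearMap.mulLeftRight K ((t₀ : Matrix n n K), ((t₀⁻¹ : GL n K) : Matrix n n K)) - LinearMap.id : Matrix n n K →ₗ[K] Matrix n n K)))
  have hΦ_right : ∀ Y : Matrix n n K, Y ∈ LinearMap.range (LinearMap.mulLeftRight K ((t₀ : Matrix n n K), ((t₀⁻¹ : GL n K) : Matrix n n K)) - LinearMap.id : Matrix n n K →ₗ[K] Matrix n n K) → Φ Y = (LinearMap.mulLeftRight K (((t₀⁻¹ : GL n K) : Matrix n n K), (t₀ : Matrix n n K)) - LinearMap.id : Matrix n n K →ₗ[K] Matrix n n K) Y :=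
    fun Y hY => LinearMap.ofIsCompl_apply_right hK (⟨Y, hY⟩ : ↥(LinearMap.range (LinearMap.mulLeftRight K ((t₀ : Matrix n n K), ((t₀⁻¹ : GL n K) : Matrix n n K)) - LinearMap.id : Matrix n n K →ₗ[K] Matrix n n K)))
  refine ⟨hc, L, Φ, fun X hX => by rw [hLL]; exact hLl_left X hX, fun X hX => by rw [hLL, hLl_right X hX]; exact hg𝔲val X, ?_, ?_, ?_, ?_⟩
  · -- decomposition law
    intro X
    have hX : X = ((Submodule.projectionOnto (((LinearMap.ker (LinearMap.mulLeftRight K ((t₀ : Matrix n n K), ((t₀⁻¹ : GL n K) : Matrix n n K)) - LinearMap.id : Matrix n n K →ₗ[K] Matrix n n K)).restrictScalars F).comap 𝔲.subtype) (((LinearMap.range (LinearMap.mulLeftRight K ((t₀ : Matrix n n K), ((t₀⁻¹ : GL n K) : Matrix n n K)) - LinearMap.id : Matrix n n K →ₗ[K] Matrix n n K)).restrictScalars F).comap 𝔲.subtype) hc X : ↥(((LinearMap.ker (LinearMap.mulLeftRight K ((t₀ : Matrix n n K), ((t₀⁻¹ : GL n K) : Matrix n n K)) - LinearMap.id : Matrix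 n n K →ₗ[K] Matrix n n K)).restrictScalars F).comap 𝔲.subtype)) : ↥𝔲) + ((Submodule.projectionOnto (((LinearMap.range (LinearMap.mulLeftRight K ((t₀ : Matrix n n K), ((t₀⁻¹ : GL n K) : Matrix n n K)) - LinearMap.id : Matrix n n K →ₗ[K] Matrix n n K)).restrictScalars F).comap 𝔲.subtype) (((LinearMap.ker (LinearMap.mulLeftRight K ((t₀ : Matrix n n K), ((t₀⁻¹ : GL n K) : Matrix n n K)) - LinearMap.id : Matrix n n K →ₗ[K] Matrix n n K)).restrictScalars F).comap 𝔲.subtype) hc.symm X : ↥(((LinearMap.range (LinearMap.mulLeftRight K ((t₀ : Matrix n n K), ((t₀⁻¹ : GL n K) : Matrix n n K)) - LinearMap.id : Matrix n n K →ₗ[K] Matrix n n K)).restrictScalars F).comap 𝔲.subtype)) : ↥𝔲) := by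
      have h := (Submodule.prodEquivOfIsCompl _ _ hc).apply_symm_apply X
      rw [Submodule.prodEquivOfIsCompl_symm_apply, Submodule.coe_prodEquivOfIsCompl'] at h
      exact h.symm
    conv_lhs => rw [hX]
    rw [map_add, hLL, hLl_left _ (Submodule.projectionOnto (((LinearMap.ker (LinearMap.mulLeftRight K ((t₀ : Matrix n n K), ((t₀⁻¹ : GL n K) : Matrix n n K)) - LinearMap.id : Matrix n n K →ₗ[K] Matrix n n K)).restrictScalars F).comap 𝔲.subtype) (((LinearMap.range (LinearMap.mulLeftRight K ((t₀ : Matrix n n K), ((t₀⁻¹ : GL n K) : Matrix n n K)) - LinearMap.id : Matrix n n K →ₗ[K] Matrix n n K)).restrictScalars F).comap 𝔲.subtype) hc X).2]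
  · -- `Φ` extends `L̃`
    intro X
    have htop : X ∈ (((LinearMap.ker (LinearMap.mulLeftRight K ((t₀ : Matrix n n K), ((t₀⁻¹ : GL n K) : Matrix n n K)) - LinearMap.id : Matrix n n K →ₗ[K] Matrix n n K)).restrictScalars F).comap 𝔲.subtype) ⊔ (((LinearMap.range (LinearMap.mulLeftRight K ((t₀ : Matrix n n K), ((t₀⁻¹ : GL n K) : Matrix n n K)) - LinearMap.id : Matrix n n K →ₗ[K] Matrix n n K)).restrictScalars F).comap 𝔲.subtype) := by rw [hc.sup_eq_top]; exact Submodule.mem_top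
    obtain ⟨a, ha, b, hb, rfl⟩ := Submodule.mem_sup.1 htop
    have haK : (a : Matrix n n K) ∈ LinearMap.ker (LinearMap.mulLeftRight K ((t₀ : Matrix n n K), ((t₀⁻¹ : GL n K) : Matrix n n K)) - LinearMap.id : Matrix n n K →ₗ[K] Matrix n n K) := by
      rw [Submodule.mem_comap, Submodule.restrictScalars_mem, Submodule.subtype_apply] at ha; exact ha
    have hbK : (b : Matrix n n K) ∈ LinearMap.range (LinearMap.mulLeftRight K ((t₀ : Matrix n n K), ((t₀⁻¹ : GL n K) : Matrix n n K)) - LinearMap.id : Matrix n n K →ₗ[K] Matrix n n K) := by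
      rw [Submodule.mem_comap, Submodule.restrictScalars_mem, Submodule.subtype_apply] at hb; exact hb
    rw [hLL, map_add, hLl_left a ha, hLl_right b hb, Submodule.coe_add, Submodule.coe_add, map_add, hΦ_left _ haK, hΦ_right _ hbK, hg𝔲val]
    rfl
  · -- (h1)
    apply LinearMap.ext
    intro Y
    rw [LinearMap.comp_apply, LinearMap.comp_apply]
    exact hΦ_right _ (LinearMap.mem_range_self _ Y)
  · -- (h2)
    intro Z hZ
    exact hΦ_left Z ((mem_ker_adSubOne_iff t₀ Z).2 hZ)

end LinearPart


end Summit.HodgeConjecture.HodgeConjecture.Cruxes.H413.F0P3cStCharTSCartanDecompositionSkew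

end
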